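import Literature.AlgebraicGeometry.Resolution.InseparableLocalUniformizationAbhyankarHolds
import Literature.AlgebraicGeometry.Resolution.JacobianRegularLocus
import Literature.AlgebraicGeometry.Resolution.LocalUniformization
import Mathlib.FieldTheory.PurelyInseparable.Basic
import HarnessLib

/-!
# Local uniformization of Abhyankar valuations (Knaf–Kuhlmann 2005 / Temkin 2013 §5)

Topic: `Literature/AlgebraicGeometry/Resolution`. Two printed results, rendered in the weak
vocabulary `IsLocallyUniformizable` of `LocalUniformization.lean` and PROVED from the tree's
discharge `Temkin2013Abhyankar_holds` (Temkin 2013, Thm. 5.5.2 (i), from Kuhlmann's generalized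
stability theorem, `InseparableLocalUniformizationAbhyankarHolds.lean`):

* `temkin2013_conclusion_of_transcendenceDefect_eq_zero` — **Temkin 2013, Thm. 1.3.2 for
  ABHYANKAR valuations, over every ground field**: for a finitely generated `K/k`, a valuation
  ring `O ⊇ k` of `K` of transcendence defect `0` (`E + F = tr.deg`) is uniformized on a finite
  purely inseparable extension `L/K` — the conclusion of the named fact `Temkin2013`, so this is
  a PROVED SLICE of that fact (as `temkin2013_conclusion_of_primeDivisor`,
  `temkin2013_conclusion_of_residueTrdeg` in `PrimeDivisors.lean` are for `(E, F) = (1, N-1)`).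
* `isLocallyUniformizable_of_transcendenceDefect_eq_zero` — **Knaf–Kuhlmann 2005, Thm. 1.1 over
  a PERFECT ground field** (where its separability hypothesis on the residue field extension is
  automatic): an Abhyankar valuation ring of a finitely generated extension of a perfect field is
  locally uniformizable ON `K` ITSELF, without any extension. Mechanism: Temkin's finite purely
  inseparable `l/k` is trivial over a perfect `k`, hence so is `L₁ = lK`, and the `l`-smooth model
  of `L₁°` is transported back to `K` along `K ≅ L₁`.
* `isLocallyUniformizable_comap_of_model` — the transport (an affine model realised inside a
  bigger field uniformizes the restricted valuation ring); same statement and proof as the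
  Summits-side helper of the same name in
  `Summits/ResolutionOfSingularities/ResolutionOfSingularities/Theorems/PAlterationPialtBridgeFoliationDescent.lean`,
  moved below the Literature/Summits line (universe-polymorphic) so that Literature can use it.

Not here: the monomialisation of a finite set `Z` and the dimension clause of KK05 Thm. 1.1, the
simultaneous / logarithmic forms of Temkin's Thm. 5.5.2, imperfect ground fields without
extension (KK05 needs `FP|K` separable there).

## Sources

* H. Knaf, F.-V. Kuhlmann, *Abhyankar places admit local uniformization in any characteristic*,
  Ann. Sci. École Norm. Sup. (4) 38 (2005) 833–846, Thm. 1.1. [KnafKuhlmann2005]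
* M. Temkin, *Inseparable local uniformization*, J. Algebra 373 (2013) 65–119
  = arXiv:0804.1554v3, Thm. 1.3.2 and Thm. 5.5.2 (i) (p. 60). [Temkin2013]
-/

noncomputable section

namespace Literature.AlgebraicGeometry.Resolution

universe u

open IsLocalRing

/-! ## Transport of a model realised inside a bigger field -/

section Transport

/-- The centre restricts: for `f : K₁ → K` and `a ∈ O ∩ K₁ = O.comap f`, `a` lies in the maximal
ideal of `O.comap f` iff `f a` lies in the maximal ideal of `O`. [folklore] -/
theorem mk_mem_maximalIdeal_comap_iff {K₁ K : Type*} [Field K₁] [Field K]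
    (O : ValuationSubring K) (f : K₁ →+* K) {a : K₁} (ha : a ∈ O.comap f) :
    (⟨a, ha⟩ : O.comap f) ∈ maximalIdeal (O.comap f) ↔ (⟨f a, ha⟩ : O) ∈ maximalIdeal O := by
  rw [← ValuationSubring.coe_mem_nonunits_iff, ← ValuationSubring.coe_mem_nonunits_iff,
    ValuationSubring.mem_nonunits_iff_or, ValuationSubring.mem_nonunits_iff_or]
  show a = 0 ∨ a⁻¹ ∉ O.comap f ↔ f a = 0 ∨ (f a)⁻¹ ∉ O
  rw [map_eq_zero f, ValuationSubring.mem_comap, map_inv₀]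

/-- Transport of regularity at a prime along a ring isomorphism `e : A ≃+* A'`: `A'_{𝔭'}` is
regular iff `A_{e⁻¹ 𝔭'}` is (`mem_regularLocus_iff_of_ringEquiv`). [folklore] -/
theorem isRegularLocalRing_localization_iff_of_ringEquiv {A A' : Type u} [CommRing A]
    [CommRing A'] (e : A ≃+* A') (P : Ideal A') [P.IsPrime] :
    IsRegularLocalRing (Localization.AtPrime P) ↔
      IsRegularLocalRing (Localization.AtPrime (P.comap (e : A →+* A'))) :=
  mem_regularLocus_iff_of_ringEquiv e ⟨P, inferInstance⟩

/-- **An affine model of `K` realised inside `L ⊇ K` uniformizes `O ∩ K`.** Let `f : K → L` be a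
`k`-algebra map of fields, `O` a valuation ring of `L`, and `A ⊆ O` a finitely generated
`k`-subalgebra of `L` contained in the image of `K`, such that every element of (the image of)
`K` is a quotient of elements of `A`, and whose local ring at the centre of `O` is regular. Then
`A ∩ K` (`A.comap f`) is a finitely generated affine model of `K` inside `O ∩ K`, regular at the
centre of `O ∩ K` — so `O ∩ K` is locally uniformizable over `k`. [folklore] -/
theorem isLocallyUniformizable_comap_of_model {k K L : Type u} [Field k] [Field K] [Field L]
    [Algebra k K] [Algebra k L] (f : K →ₐ[k] L) (O : ValuationSubring L) (A : Subalgebra k L)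
    (hA : A.toSubring ≤ O.toSubring) (hAK : ∀ x ∈ A, x ∈ Set.range f) (hfg : A.FG)
    (hfrac : ∀ z : K, ∃ a b : L, a ∈ A ∧ b ∈ A ∧ b ≠ 0 ∧ f z = a / b)
    (hreg : IsRegularLocalRing (Localization.AtPrime
      (Ideal.comap (Subring.inclusion hA) (maximalIdeal O)))) :
    IsLocallyUniformizable k K (O.comap (f : K →+* L)) := by
  classical
  have hfinj : Function.Injective f := (f : K →+* L).injective
  set A₀ : Subalgebra k K := A.comap f with hA₀
  have hmap : A₀.map f = A := by
    rw [hA₀, Subalgebra.map_comap_eq]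
    exact inf_eq_left.mpr fun x hx => hAK x hx
  have h₀ : A₀.toSubring ≤ (O.comap (f : K →+* L)).toSubring := fun x hx => hA hx
  have hA₀fg : A₀.FG := Subalgebra.fg_of_fg_map _ f hfinj (by rw [hmap]; exact hfg)
  have hA₀fr : IsFractionRing A₀ K := by
    refine IsFractionRing.of_field A₀ K fun z => ?_
    obtain ⟨a, b, ha, hb, hb0, hz⟩ := hfrac z
    obtain ⟨a₀, rfl⟩ := hAK a ha
    obtain ⟨b₀, rfl⟩ := hAK b hb
    refine ⟨⟨a₀, show f a₀ ∈ A from ha⟩, ⟨b₀, show f b₀ ∈ A from hb⟩, hfinj ?_⟩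
    rw [hz, map_div₀]
    rfl
  refine ⟨A₀, h₀, hA₀fg, hA₀fr, ?_⟩
  -- transport of the local ring at the centre along `A₀ ≅ A₀.map f = A`
  have hmapS : A₀.toSubring.map (f : K →+* L) = A.toSubring := by
    ext z
    simp only [Subring.mem_map, Subalgebra.mem_toSubring]
    constructor
    · rintro ⟨x, hx, rfl⟩
      exact hx
    · intro hz
      obtain ⟨x, rfl⟩ := hAK z hz
      exact ⟨x, hz, rfl⟩
  let e : A₀.toSubring ≃+* A.toSubring :=
    (A₀.toSubring.equivMapOfInjective (f : K →+* L) hfinj).trans (RingEquiv.subringCongr hmapS)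
  have he : ∀ a : A₀.toSubring, ((e a : A.toSubring) : L) = f a := fun a => rfl
  set P : Ideal A.toSubring := Ideal.comap (Subring.inclusion hA) (maximalIdeal O) with hP
  haveI hPp : P.IsPrime := Ideal.comap_isPrime _ _
  have hPe : P.comap (e : A₀.toSubring →+* A.toSubring) =
      Ideal.comap (Subring.inclusion h₀) (maximalIdeal (O.comap (f : K →+* L))) := by
    ext a
    have h2 : Subring.inclusion hA (e a) = ⟨f a, hA (e a).2⟩ := Subtype.ext (he a)
    simp only [Ideal.mem_comap, hP, RingHom.coe_coe]
    rw [h2]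
    exact (mk_mem_maximalIdeal_comap_iff O (f : K →+* L) (h₀ a.2)).symm
  haveI : (P.comap (e : A₀.toSubring →+* A.toSubring)).IsPrime := Ideal.comap_isPrime _ _
  exact isRegularLocalRing_localization_atPrime_congr hPe
    ((isRegularLocalRing_localization_iff_of_ringEquiv e P).mp hreg)

end Transport

/-! ## Abhyankar valuations: Temkin's conclusion over every field, and LU over perfect fields -/

section Abhyankar

variable {k K : Type u} [Field k] [Field K] [Algebra k K]

/-- **Temkin 2013, Thm. 1.3.2 for Abhyankar valuations — PROVED slice of the named fact
`Temkin2013`.** For a finitely generated `K/k` (any field `k`) and a valuation ring `O ⊇ k` of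
`K` of transcendence defect `0` (`E_O + F_O = tr.deg_k K`, Temkin §2.1), there are a finite purely
inseparable extension `L/K` and the valuation ring `O'` of `L` over `O` which is locally
uniformizable over `k`. This is Thm. 5.5.2 (i) of the source (`Temkin2013Abhyankar_holds`, with
`K₁ = K`), forgetting the refinement, the `l`-structure and smoothness: the `l`-model `Nr_{L₁}(X')`
is finitely generated over `k` and regular at the centre.
[cite: Temkin2013, Thm. 1.3.2 and Thm. 5.5.2 (i) (p. 60 of arXiv:0804.1554v3)] -/
theorem temkin2013_conclusion_of_transcendenceDefect_eq_zero
    (hfg : (⊤ : IntermediateField k K).FG) (O : ValuationSubring K)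
    (hk : ∀ c : k, algebraMap k K c ∈ O) (h0 : transcendenceDefect k O hk = 0) :
    ∃ (L : Type u) (_ : Field L) (_ : Algebra K L) (_ : Algebra k L) (_ : IsScalarTower k K L),
      FiniteDimensional K L ∧ IsPurelyInseparable K L ∧
      ∃ O' : ValuationSubring L, O'.comap (algebraMap K L) = O ∧
        IsLocallyUniformizable k L O' := by
  classical
  obtain ⟨A, hAO, hAfg, hAfr⟩ := exists_affineModel k K hfg O hk
  have hOO : O.comap (algebraMap K K) = O := by ext x; simp
  obtain ⟨L₁, iF, iAK₁, iAK, iAk, iT₁, iT₂, hfin, hpi, l, -, -, -, A', -, -, -, -, O₁', hO₁', N,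
    hN, -, hNfg, hNfr, -, -, hreg⟩ :=
    Temkin2013Abhyankar_holds k K hfg O hk h0 A hAO hAfg hAfr K
      (inferInstance : FiniteDimensional K K) O hOO
  -- the two `K`-algebra structures on `L₁` (via `K₁ = K` and the direct one) coincide
  have hinst : iAK = iAK₁ := by
    refine Algebra.algebra_ext _ _ fun r => ?_
    have := @IsScalarTower.algebraMap_apply K K L₁ _ _ _ _ iAK₁ iAK iT₁ r
    simpa using this
  subst hinst
  exact ⟨L₁, iF, iAK, iAk, iT₂, hfin, hpi, O₁', hO₁', N.restrictScalars k, hN, hNfg, hNfr, hreg⟩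

/-- **Knaf–Kuhlmann 2005, Thm. 1.1 over a perfect ground field: Abhyankar valuations are
locally uniformizable, without extending `K`.** For a PERFECT field `k`, a finitely generated
`K/k` and a valuation ring `O ⊇ k` of `K` of transcendence defect `0`, some finitely generated
`k`-subalgebra `A ⊆ O` with `Frac A = K` is regular at the centre of `O`
(`IsLocallyUniformizable k K O`). Printed: "Let `P` be a `K`-trivial Abhyankar place of the
function field `F|K`, and assume that `FP|K` is separable. … Then the pair `(P, Z)` is
`K`-uniformizable on a variety `X` such that `P` is centered in a smooth point `x ∈ X`" — over a
perfect `K` the separability hypothesis is void; smooth ⇒ regular. Proof here: Temkin's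
Thm. 5.5.2 (i) (`Temkin2013Abhyankar_holds`, `K₁ = K`) yields `l/k` finite purely inseparable —
trivial, `k` being perfect — with `L₁ = lK₁`, so `K → L₁` is a `k`-isomorphism, and the regular
centre of the model `Nr_{L₁}(X')` transports to `K` (`isLocallyUniformizable_comap_of_model`).
In every transcendence degree; the open local uniformization problem in positive characteristic
therefore lives entirely at valuations of POSITIVE transcendence defect.
[cite: KnafKuhlmann2005, Thm. 1.1] -/
theorem isLocallyUniformizable_of_transcendenceDefect_eq_zero [PerfectField k]
    (hfg : (⊤ : IntermediateField k K).FG) (O : ValuationSubring K)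
    (hk : ∀ c : k, algebraMap k K c ∈ O) (h0 : transcendenceDefect k O hk = 0) :
    IsLocallyUniformizable k K O := by
  classical
  obtain ⟨A, hAO, hAfg, hAfr⟩ := exists_affineModel k K hfg O hk
  have hOO : O.comap (algebraMap K K) = O := by ext x; simp
  obtain ⟨L₁, iF, iAK₁, iAK, iAk, iT₁, iT₂, hfin, hpi, l, hlfin, hlpi, hadj, A', -, -, -, -, O₁',
    hO₁', N, hN, -, hNfg, hNfr, -, -, hreg⟩ :=
    Temkin2013Abhyankar_holds k K hfg O hk h0 A hAO hAfg hAfr K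
      (inferInstance : FiniteDimensional K K) O hOO
  -- the two `K`-algebra structures on `L₁` (via `K₁ = K` and the direct one) coincide
  have hinst : iAK = iAK₁ := by
    refine Algebra.algebra_ext _ _ fun r => ?_
    have := @IsScalarTower.algebraMap_apply K K L₁ _ _ _ _ iAK₁ iAK iT₁ r
    simpa using this
  subst hinst
  -- `l/k` is purely inseparable over a perfect field, hence trivial
  haveI : IsPurelyInseparable k l := hlpi
  have hl : ∀ x ∈ (l : Set L₁), x ∈ Set.range (algebraMap k L₁) := by
    intro x hx
    obtain ⟨c, hc⟩ := IsPurelyInseparable.surjective_algebraMap_of_isSeparable k l ⟨x, hx⟩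
    exact ⟨c, by rw [IsScalarTower.algebraMap_apply k l L₁, hc]; rfl⟩
  -- hence `L₁ = lK = K`: the structure map `K → L₁` is onto
  set f : K →ₐ[k] L₁ := IsScalarTower.toAlgHom k K L₁ with hf
  have hfsurj : Function.Surjective f := by
    have hle : Algebra.adjoin K (l : Set L₁) ≤ ⊥ := by
      refine Algebra.adjoin_le fun x hx => ?_
      obtain ⟨c, rfl⟩ := hl x hx
      rw [IsScalarTower.algebraMap_apply k K L₁]
      exact Subalgebra.algebraMap_mem _ _
    intro z
    have hz : z ∈ (⊥ : Subalgebra K L₁) := hle (hadj ▸ Algebra.mem_top)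
    obtain ⟨y, hy⟩ := Algebra.mem_bot.mp hz
    exact ⟨y, hy⟩
  -- transport the model `N ⊆ L₁°` back to `K`
  have hcomap : O₁'.comap (f : K →+* L₁) = O := by
    rw [← hO₁']; rfl
  rw [← hcomap]
  haveI := hNfr
  refine isLocallyUniformizable_comap_of_model f O₁' (N.restrictScalars k) hN
    (fun x _ => hfsurj x) hNfg (fun z => ?_) hreg
  obtain ⟨a, b, hb, hab⟩ := IsFractionRing.div_surjective (A := N) (f z)
  exact ⟨a, b, a.2, b.2, fun h => nonZeroDivisors.ne_zero hb (Subtype.ext h), hab.symm⟩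

/-- The same with the hypothesis in Abhyankar's printed form `E + F = tr.deg_k K`
(`transcendenceDefect_eq_zero_iff`). [cite: KnafKuhlmann2005, Thm. 1.1] -/
theorem isLocallyUniformizable_of_ratRank_add_residueTrdeg_eq [PerfectField k]
    (hfg : (⊤ : IntermediateField k K).FG) (O : ValuationSubring K)
    (hk : ∀ c : k, algebraMap k K c ∈ O)
    (hEF : ratRank O + residueTrdeg k O hk = Algebra.trdeg k K) :
    IsLocallyUniformizable k K O :=
  isLocallyUniformizable_of_transcendenceDefect_eq_zero hfg O hk
    ((transcendenceDefect_eq_zero_iff O hk (trdeg_lt_aleph0_of_fg hfg)).mpr hEF)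

end Abhyankar

end Literature.AlgebraicGeometry.Resolution

end
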